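import Summits.AtomisticToContinuum.FouriersLaw.Theses.PuiseuxTransferLedger
import Summits.AtomisticToContinuum.FouriersLaw.Theorems.PuiseuxTransferLedgerExponentiallyAffineResistanceOfDecoupling
import Summits.AtomisticToContinuum.FouriersLaw.Theorems.PuiseuxTransferLedgerContactIdentity
import Summits.AtomisticToContinuum.FouriersLaw.Theorems.PuiseuxTransferLedgerSeriesLedgerGlue
import Summits.AtomisticToContinuum.FouriersLaw.Theorems.PuiseuxTransferLedgerFiniteResponseProfile
import Literature.MathematicalPhysics.KineticTheory.ChainReflection

/-!
# `ExponentiallyAffineResistance` from the two cruxes and ONE-SIDED far-contact decoupling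
(support for stmt-AtomisticToContinuum-12115)

The by-product item `ExponentiallyAffineResistance` of route `PuiseuxTransferLedger` (Fourier's law
for the pinned anharmonic chain WITH contact resistance and exponentially small corrections,
`|(N-1)/D_N - ((N-1) r + ρ)| ≤ C θ^N`) is summit-hard
(`fouriersLaw_of_exponentiallyAffineResistance`, file `…Reductions`). Its only known derivation inside
the route is the conditional assembly `exponentiallyAffineResistance_of_farContactDecoupling`
(file `…OfDecoupling`): the six hypotheses of the deciding theorem `closes` plus a TWO-SIDED
far-contact decoupling hypothesis (local bond resistances of the `N`- and `(N+1)`-chains compared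
both left-aligned and right-aligned).

This file sharpens that reduction to the form a planner can file:

* the four support hypotheses are DISCHARGED by the in-tree proofs (`PositiveConductance_holds`,
  `finiteResponseProfile_proof`, `contactIdentity_proof`, `seriesLedgerGlue_proof`), leaving exactly
  the two cruxes `TwoModeBulk`, `NonBallistic`;
* the decoupling hypothesis is reduced to its ONE-SIDED (left-aligned) form — literally the
  statement `FarContactDecoupling` foreseen in the route header, `|r_N(i) - r_{N+1}(i)| ≤ C θ^(N-2-i)` —
  using the left–right reflection covariance of weak steady states
  (`Literature/…/ChainReflection.lean`): under weak-NESS uniqueness the steady-state family is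
  reflection-covariant, `μ_(N,T_R,T_L) = R_* μ_(N,T_L,T_R)`, so the kinetic-temperature response
  profile is ODD under the site reflection, `θ_N(N-1-i) = -θ_N(i)` (`profileResponse_rev_eq_neg`), the
  local bond resistances are reflection-symmetric, `r_N(N-2-i) = r_N(i)`, and the right-aligned
  decoupling inequality IS the left-aligned one read on the reflected bonds.

Result: `exponentiallyAffineResistance_of_cruxes : TwoModeBulk → NonBallistic → FCD → EAR` with
`FCD` one-sided. No definitions; nothing here is specific to the exponential rate beyond what
`exponentialLedgerGlue` consumes.
-/

namespace Summit.AtomisticToContinuum.FouriersLaw.Theorems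

open MeasureTheory Filter Topology Finset
open Summit.AtomisticToContinuum.FouriersLaw.Theses.PuiseuxTransferLedger
open Literature.MathematicalPhysics.KineticTheory.HeatConduction

section Reflection

variable {ω₂ lam β γ : ℝ}

/-- **Reflection covariance of a steady-state family under uniqueness.** If weak steady states of
the pinned chain are unique at positive temperatures and `μ N T_L T_R` is a steady-state family,
then exchanging the bath temperatures is the push-forward under the site reflection
`i ↦ N-1-i`: `μ_(N,T_R,T_L) = R_* μ_(N,T_L,T_R)` (`R_* μ` is a steady state at the exchanged
temperatures, `pinnedChain_isSteadyState_map_siteReflection`). [folklore] -/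
theorem steadyFamily_swap_eq_map_siteReflection
    (huniq : ∀ (N : ℕ) (T_L T_R : ℝ), 0 < T_L → 0 < T_R →
      ∀ μ ν : Measure (PhaseSpace N), (pinnedChain ω₂ lam β γ).IsSteadyState N T_L T_R μ →
        (pinnedChain ω₂ lam β γ).IsSteadyState N T_L T_R ν → μ = ν)
    {μ : (N : ℕ) → ℝ → ℝ → Measure (PhaseSpace N)}
    (hμ : ∀ (N : ℕ) (T_L T_R : ℝ), 0 < T_L → 0 < T_R →
      (pinnedChain ω₂ lam β γ).IsSteadyState N T_L T_R (μ N T_L T_R))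
    (N : ℕ) {T_L T_R : ℝ} (hL : 0 < T_L) (hR : 0 < T_R) :
    μ N T_R T_L = (μ N T_L T_R).map (siteReflection N) :=
  huniq N T_R T_L hR hL _ _ (hμ N T_R T_L hR hL)
    (pinnedChain_isSteadyState_map_siteReflection (hμ N T_L T_R hL hR))

/-- **Kinetic temperatures at reflected sites.** Along a reflection-covariant family the second
moment of `p_(N-1-i)` at bath temperatures `(T_L, T_R)` equals the second moment of `p_i` at the
exchanged temperatures `(T_R, T_L)`. [folklore] -/
theorem integral_sq_momentum_rev
    (huniq : ∀ (N : ℕ) (T_L T_R : ℝ), 0 < T_L → 0 < T_R →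
      ∀ μ ν : Measure (PhaseSpace N), (pinnedChain ω₂ lam β γ).IsSteadyState N T_L T_R μ →
        (pinnedChain ω₂ lam β γ).IsSteadyState N T_L T_R ν → μ = ν)
    {μ : (N : ℕ) → ℝ → ℝ → Measure (PhaseSpace N)}
    (hμ : ∀ (N : ℕ) (T_L T_R : ℝ), 0 < T_L → 0 < T_R →
      (pinnedChain ω₂ lam β γ).IsSteadyState N T_L T_R (μ N T_L T_R))
    (N : ℕ) {T_L T_R : ℝ} (hL : 0 < T_L) (hR : 0 < T_R) (i : Fin N) :
    ∫ x, (x.2 (Fin.rev i)) ^ 2 ∂(μ N T_L T_R) = ∫ x, (x.2 i) ^ 2 ∂(μ N T_R T_L) := by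
  rw [steadyFamily_swap_eq_map_siteReflection huniq hμ N hL hR,
    show (∫ x, (x.2 i) ^ 2 ∂((μ N T_L T_R).map (siteReflection N))) =
        ∫ x, ((siteReflection N x).2 i) ^ 2 ∂(μ N T_L T_R) from
      integral_map_equiv (siteReflectionEquiv N) (fun x : PhaseSpace N => (x.2 i) ^ 2)]
  rfl

/-- **The profile difference quotient at a reflected site.** For `0 < |δ| < 2T` the difference
quotient of `p_(N-1-i)²` at `δ` is minus the difference quotient of `p_i²` at `-δ` (exchange of the
baths = `δ ↦ -δ`, and the equilibrium member `μ_(N,T,T)` is reflection-invariant). [folklore] -/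
theorem profileQuotient_rev
    (huniq : ∀ (N : ℕ) (T_L T_R : ℝ), 0 < T_L → 0 < T_R →
      ∀ μ ν : Measure (PhaseSpace N), (pinnedChain ω₂ lam β γ).IsSteadyState N T_L T_R μ →
        (pinnedChain ω₂ lam β γ).IsSteadyState N T_L T_R ν → μ = ν)
    {μ : (N : ℕ) → ℝ → ℝ → Measure (PhaseSpace N)}
    (hμ : ∀ (N : ℕ) (T_L T_R : ℝ), 0 < T_L → 0 < T_R →
      (pinnedChain ω₂ lam β γ).IsSteadyState N T_L T_R (μ N T_L T_R))
    (N : ℕ) {T : ℝ} (hT : 0 < T) (i : Fin N) :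
    ∀ᶠ δ in 𝓝[≠] (0 : ℝ),
      ((∫ x, (x.2 (Fin.rev i)) ^ 2 ∂(μ N (T + δ / 2) (T - δ / 2))) -
          ∫ x, (x.2 (Fin.rev i)) ^ 2 ∂(μ N T T)) / δ =
        -(((∫ x, (x.2 i) ^ 2 ∂(μ N (T + -δ / 2) (T - -δ / 2))) -
            ∫ x, (x.2 i) ^ 2 ∂(μ N T T)) / -δ) := by
  have hnear : ∀ᶠ δ in 𝓝 (0 : ℝ), 0 < T + δ / 2 ∧ 0 < T - δ / 2 := by
    have hmem : Set.Ioo (-(2 * T)) (2 * T) ∈ 𝓝 (0 : ℝ) :=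
      Ioo_mem_nhds (by linarith) (by linarith)
    filter_upwards [hmem] with δ hδ
    obtain ⟨h1, h2⟩ := hδ
    constructor <;> linarith
  filter_upwards [eventually_nhdsWithin_of_eventually_nhds hnear] with δ hδ
  rw [integral_sq_momentum_rev huniq hμ N hδ.1 hδ.2 i, integral_sq_momentum_rev huniq hμ N hT hT i]
  have e1 : T + -δ / 2 = T - δ / 2 := by ring
  have e2 : T - -δ / 2 = T + δ / 2 := by ring
  rw [e1, e2, div_neg, neg_neg]

/-- **The kinetic-temperature response profile is odd under the site reflection.** Under weak-NESS
uniqueness, along any steady-state family and at `T > 0`: if the profile difference quotient at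
site `i` tends to `a` as `δ → 0`, `δ ≠ 0`, then the one at the reflected site `N-1-i` tends to
`-a`. [folklore] -/
theorem profileResponse_rev
    (huniq : ∀ (N : ℕ) (T_L T_R : ℝ), 0 < T_L → 0 < T_R →
      ∀ μ ν : Measure (PhaseSpace N), (pinnedChain ω₂ lam β γ).IsSteadyState N T_L T_R μ →
        (pinnedChain ω₂ lam β γ).IsSteadyState N T_L T_R ν → μ = ν)
    {μ : (N : ℕ) → ℝ → ℝ → Measure (PhaseSpace N)}
    (hμ : ∀ (N : ℕ) (T_L T_R : ℝ), 0 < T_L → 0 < T_R →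
      (pinnedChain ω₂ lam β γ).IsSteadyState N T_L T_R (μ N T_L T_R))
    (N : ℕ) {T : ℝ} (hT : 0 < T) (i : Fin N) {a : ℝ}
    (ha : Tendsto (fun δ : ℝ =>
      ((∫ x, (x.2 i) ^ 2 ∂(μ N (T + δ / 2) (T - δ / 2))) - ∫ x, (x.2 i) ^ 2 ∂(μ N T T)) / δ)
      (𝓝[≠] 0) (𝓝 a)) :
    Tendsto (fun δ : ℝ =>
      ((∫ x, (x.2 (Fin.rev i)) ^ 2 ∂(μ N (T + δ / 2) (T - δ / 2))) -
          ∫ x, (x.2 (Fin.rev i)) ^ 2 ∂(μ N T T)) / δ)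
      (𝓝[≠] 0) (𝓝 (-a)) := by
  -- `h ↦ -h` maps the punctured neighbourhood of `0` to itself
  have hneg : Tendsto (fun h : ℝ => -h) (𝓝[≠] 0) (𝓝[≠] 0) := by
    refine tendsto_nhdsWithin_iff.2 ⟨?_, ?_⟩
    · have h := (continuous_neg : Continuous fun h : ℝ => -h).tendsto 0
      rw [neg_zero] at h
      exact h.mono_left nhdsWithin_le_nhds
    · filter_upwards [self_mem_nhdsWithin] with h hh
      simpa using hh
  have h := (ha.comp hneg).neg
  refine h.congr' ?_
  filter_upwards [profileQuotient_rev huniq hμ N hT i] with δ hδ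
  rw [hδ]
  rfl

/-- **Oddness of the response profile, pointwise form**: if `t : Fin N → ℝ` collects the limits of
the profile difference quotients at all sites, then `t (N-1-i) = -t i`. [folklore] -/
theorem profileResponse_rev_eq_neg
    (huniq : ∀ (N : ℕ) (T_L T_R : ℝ), 0 < T_L → 0 < T_R →
      ∀ μ ν : Measure (PhaseSpace N), (pinnedChain ω₂ lam β γ).IsSteadyState N T_L T_R μ →
        (pinnedChain ω₂ lam β γ).IsSteadyState N T_L T_R ν → μ = ν)
    {μ : (N : ℕ) → ℝ → ℝ → Measure (PhaseSpace N)}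
    (hμ : ∀ (N : ℕ) (T_L T_R : ℝ), 0 < T_L → 0 < T_R →
      (pinnedChain ω₂ lam β γ).IsSteadyState N T_L T_R (μ N T_L T_R))
    (N : ℕ) {T : ℝ} (hT : 0 < T) {t : Fin N → ℝ}
    (ht : ∀ i : Fin N, Tendsto (fun δ : ℝ =>
      ((∫ x, (x.2 i) ^ 2 ∂(μ N (T + δ / 2) (T - δ / 2))) - ∫ x, (x.2 i) ^ 2 ∂(μ N T T)) / δ)
      (𝓝[≠] 0) (𝓝 (t i))) (i : Fin N) :
    t (Fin.rev i) = -t i :=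
  tendsto_nhds_unique (ht (Fin.rev i)) (profileResponse_rev huniq hμ N hT i (ht i))

/-- **The local bond drops are reflection-symmetric**: for a bond `(i, i+1)` the profile drop
`t i - t (i+1)` equals the drop `t (N-2-i) - t (N-1-i)` over the reflected bond (oddness of the
profile). [folklore] -/
theorem profileDrop_rev
    (huniq : ∀ (N : ℕ) (T_L T_R : ℝ), 0 < T_L → 0 < T_R →
      ∀ μ ν : Measure (PhaseSpace N), (pinnedChain ω₂ lam β γ).IsSteadyState N T_L T_R μ →
        (pinnedChain ω₂ lam β γ).IsSteadyState N T_L T_R ν → μ = ν)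
    {μ : (N : ℕ) → ℝ → ℝ → Measure (PhaseSpace N)}
    (hμ : ∀ (N : ℕ) (T_L T_R : ℝ), 0 < T_L → 0 < T_R →
      (pinnedChain ω₂ lam β γ).IsSteadyState N T_L T_R (μ N T_L T_R))
    (N : ℕ) {T : ℝ} (hT : 0 < T) {t : Fin N → ℝ}
    (ht : ∀ i : Fin N, Tendsto (fun δ : ℝ =>
      ((∫ x, (x.2 i) ^ 2 ∂(μ N (T + δ / 2) (T - δ / 2))) - ∫ x, (x.2 i) ^ 2 ∂(μ N T T)) / δ)
      (𝓝[≠] 0) (𝓝 (t i))) (i j : Fin N) :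
    t i - t j = t (Fin.rev j) - t (Fin.rev i) := by
  rw [profileResponse_rev_eq_neg huniq hμ N hT ht i, profileResponse_rev_eq_neg huniq hμ N hT ht j]
  ring

end Reflection

/-- **`ExponentiallyAffineResistance` from the two cruxes and one-sided far-contact decoupling.**
The rank-2 crux `TwoModeBulk`, the rank-3 crux `NonBallistic` and the LEFT-ALIGNED far-contact
decoupling of the local bond resistances `r_N(i) = (θ_N(i) - θ_N(i+1))/(D_N/(N-1))` — along any
steady-state family (under weak-NESS uniqueness) and `T > 0` there are `θ ∈ [0,1)`, `C` with
`|r_N(i) - r_{N+1}(i)| ≤ C θ^(N-2-i)` for every bond `(i, i+1)` of the `N`-chain (bonds at the same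
distance from the left contact of the `N`- and the `(N+1)`-chain differ by an amount exponentially
small in their distance to the RIGHT contact; the route header's `FarContactDecoupling`) — imply the
by-product `ExponentiallyAffineResistance`. Proof: the four support hypotheses of
`exponentiallyAffineResistance_of_farContactDecoupling` are the proved items
(`PositiveConductance_holds`, `finiteResponseProfile_proof`, `contactIdentity_proof`,
`seriesLedgerGlue_proof`); its right-aligned decoupling inequality for the bond `(i, i+1)` is the
left-aligned one for the reflected bonds `(N-2-i, N-1-i)` of the `N`-chain and `(N-1-i, N-i)` read
as `rev` of `(i+1, i+2)` in the `(N+1)`-chain, by the reflection symmetry of the profile drops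
(`profileDrop_rev`). [folklore] -/
theorem exponentiallyAffineResistance_of_cruxes (hTM : TwoModeBulk) (hNB : NonBallistic)
    (hFCD : ∀ ω₂ lam β γ : ℝ, 0 < ω₂ → 0 < lam → 0 < β → 0 < γ →
      (∀ (N : ℕ) (T_L T_R : ℝ), 0 < T_L → 0 < T_R →
        ∀ μ ν : Measure (PhaseSpace N), (pinnedChain ω₂ lam β γ).IsSteadyState N T_L T_R μ →
          (pinnedChain ω₂ lam β γ).IsSteadyState N T_L T_R ν → μ = ν) →
      ∀ μ : (N : ℕ) → ℝ → ℝ → Measure (PhaseSpace N),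
        (∀ (N : ℕ) (T_L T_R : ℝ), 0 < T_L → 0 < T_R →
          (pinnedChain ω₂ lam β γ).IsSteadyState N T_L T_R (μ N T_L T_R)) →
        ∀ T : ℝ, 0 < T → ∃ θ C : ℝ, 0 ≤ θ ∧ θ < 1 ∧
          ∀ (N : ℕ) (d d' : ℝ) (t : Fin N → ℝ) (t' : Fin (N + 1) → ℝ),
            Tendsto (fun δ : ℝ =>
              (pinnedChain ω₂ lam β γ).totalCurrent (μ N (T + δ / 2) (T - δ / 2)) / δ)
              (𝓝[≠] 0) (𝓝 d) →
            Tendsto (fun δ : ℝ =>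
              (pinnedChain ω₂ lam β γ).totalCurrent (μ (N + 1) (T + δ / 2) (T - δ / 2)) / δ)
              (𝓝[≠] 0) (𝓝 d') →
            (∀ i : Fin N, Tendsto (fun δ : ℝ =>
              ((∫ x, (x.2 i) ^ 2 ∂(μ N (T + δ / 2) (T - δ / 2))) -
                ∫ x, (x.2 i) ^ 2 ∂(μ N T T)) / δ) (𝓝[≠] 0) (𝓝 (t i))) →
            (∀ i : Fin (N + 1), Tendsto (fun δ : ℝ =>
              ((∫ x, (x.2 i) ^ 2 ∂(μ (N + 1) (T + δ / 2) (T - δ / 2))) -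
                ∫ x, (x.2 i) ^ 2 ∂(μ (N + 1) T T)) / δ) (𝓝[≠] 0) (𝓝 (t' i))) →
            ∀ (i j : Fin N) (i' j' : Fin (N + 1)), j.val = i.val + 1 → j'.val = i'.val + 1 →
              i'.val = i.val →
                |(t i - t j) / (d / ((N : ℝ) - 1)) - (t' i' - t' j') / (d' / (N : ℝ))| ≤
                  C * θ ^ (N - 2 - i.val)) :
    ExponentiallyAffineResistance := by
  refine exponentiallyAffineResistance_of_farContactDecoupling PositiveConductance_holds
    PuiseuxTransferLedgerFiniteResponseProfile.finiteResponseProfile_proof contactIdentity_proof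
    seriesLedgerGlue_proof hTM hNB ?_
  intro ω₂ lam β γ hω hl hβ hγ huniq μ hμ T hT
  obtain ⟨θ, C, hθ0, hθ1, hdec⟩ := hFCD ω₂ lam β γ hω hl hβ hγ huniq μ hμ T hT
  refine ⟨θ, C, hθ0, hθ1, ?_⟩
  intro N d d' t t' hd hd' ht ht' i j i' j' hj hj'
  refine ⟨fun hi' => hdec N d d' t t' hd hd' ht ht' i j i' j' hj hj' hi', fun hi' => ?_⟩
  -- the right-aligned inequality: read the left-aligned one on the reflected bonds
  have hiN : i.val + 2 ≤ N := by have := j.isLt; omega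
  have hk : (Fin.rev j).val = N - 2 - i.val := by rw [Fin.val_rev]; omega
  have hl' : (Fin.rev i).val = (Fin.rev j).val + 1 := by rw [Fin.val_rev, Fin.val_rev]; omega
  have hk' : (Fin.rev j').val = (Fin.rev j).val := by rw [Fin.val_rev, Fin.val_rev]; omega
  have hl'' : (Fin.rev i').val = (Fin.rev j').val + 1 := by rw [Fin.val_rev, Fin.val_rev]; omega
  have h := hdec N d d' t t' hd hd' ht ht' (Fin.rev j) (Fin.rev i) (Fin.rev j') (Fin.rev i')
    hl' hl'' hk'
  rw [profileDrop_rev huniq hμ N hT ht i j, profileDrop_rev huniq hμ (N + 1) hT ht' i' j']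
  have hexp : N - 2 - (Fin.rev j).val = i.val := by rw [hk]; omega
  rw [hexp] at h
  exact h

end Summit.AtomisticToContinuum.FouriersLaw.Theorems
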